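import Mathlib
import HarnessLib
import Summits.NavierStokesRegularity.NavierStokesRegularity.Theorems.LocalSineTubeDoorProfileAlignedWindowRigidityAncient
import Summits.NavierStokesRegularity.NavierStokesRegularity.Theorems.PoloidalWindowDoorLrcModEntireExtremalThread

/-!
# Route `PoloidalWindowDoor`, item `LrcModEntire` (stmt-NavierStokesRegularity-20428) / crux K2 (stmt-19708) —
# the THREADED HOT SPOT: first- and second-order pins of `v₂` at the vertical hot spot, and the packaged normal form

LEAD of item 20428 ns-poloidal-K2-p3 g10 (`--supports stmt-NavierStokesRegularity-20428 --as helper`).  RELAY LANDING WITH AUTHOR CREDIT: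
the pin lemmas below are ns-idea-8 g2's sorry-free rung of the ideator LINES `far_thread` / `thread_axis` (crux workfiles
`Cruxes/PoloidalWindowRigidity/Lines/thread_axis_rung.lean` v6 §S5a/S5b, `far_thread.lean` v4 `threadPin_of_hotSpot`), moved VERBATIM
(proofs unchanged) into the Theorems tree so that they can be cited by name; the ideator seat cannot write here (perm.theorems-prover-only).
Combined with the hot-spot existence `…LrcModEntireExtremalThread.extremalThread` (this seat, p629364) they give the packaged normal form
`exists_threadedHotSpot` for the THICK column of the item: a poloidal class profile with `v₂ ≢ 0` may be replaced by one of the same class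
whose scale-invariant vertical size peaks at `(−1,0)`, where `∇v₂ = 0` (a THREAD), `∂ₜv₂ = v₂/2` and `v₂·Δv₂ ≤ 0`.

* `fderiv_apply_coord`, `threadPin_of_hotSpot` (far_thread v4) — the slice gradient of `v₂` vanishes at the hot spot;
* `threadTimePin`, `deriv2_nonpos_of_isLocalMax`, `deriv2_line_eq_iteratedFDeriv`, `threadSpacePin`, `threadSignedPin` (thread_axis_rung v6,
  = the lines' shared stub S5 `stub_threadSignedPin` VERBATIM) — `∂ₜv₂(−1,0) = v₂(−1,0)/2` and `v₂(−1,0)·Δv₂(−1,·)(0) ≤ 0`;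
* `exists_threadedHotSpot` — the package (S1 + thread + S5).

WHAT THIS IS NOT: not a claim about Navier–Stokes regularity, not the thick stub, not an adoption of LINE 4/5 — calculus at a hot spot
(bears_on LADDER-NS N0, rung N0-LocalTubeDoorPoloidal). [folklore]
-/

noncomputable section

-- the summit and its single sub-problem share the name (CONVENTIONS §1), as in every Theorems file
set_option linter.dupNamespace false

namespace Summit.NavierStokesRegularity.NavierStokesRegularity.Theorems.PoloidalWindowDoorLrcModEntireThreadPins

open MeasureTheory Set Function Filter Topology
open scoped RealInnerProductSpace InnerProductSpace Laplacian
open Literature.Analysis Literature.Analysis.FluidPDE Literature.Analysis.UnboundedOperators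
open Summit.NavierStokesRegularity.NavierStokesRegularity.Theorems.LocalSineTubeDoorProfileAlignedWindowRigidityAncient
open Summit.NavierStokesRegularity.NavierStokesRegularity.Theorems.PoloidalWindowDoorLrcModEntireExtremalThread

/-! ### The hot spot is a thread (far_thread v4, ns-idea-8 g2) -/

/-- Component of a derivative = derivative of the component. -/
theorem fderiv_apply_coord (u : EuclideanSpace ℝ (Fin 3) → EuclideanSpace ℝ (Fin 3)) {x : EuclideanSpace ℝ (Fin 3)}
    (hu : DifferentiableAt ℝ u x) (h : EuclideanSpace ℝ (Fin 3)) (i : Fin 3) :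
    fderiv ℝ (fun z => u z i) x h = fderiv ℝ u x h i := by
  have hc := ((EuclideanSpace.proj (𝕜 := ℝ) i).hasFDerivAt.comp x hu.hasFDerivAt).fderiv
  have hfun : (fun z => u z i) = (EuclideanSpace.proj (𝕜 := ℝ) i) ∘ u := rfl
  rw [hfun, hc]
  rfl

/-- **THE HOT SPOT IS A THREAD (proved).**  Under the normalisation of `stub_extremalThread` the slice `v(−1)` has `∇v₂(0) = 0`:
`|v₂(−1,·)|` attains a global maximum at `0`, and the slice is differentiable (real-analytic, tree `analyticOnNhd_slice`). -/
theorem threadPin_of_hotSpot {C : ℝ} {v : ℝ → EuclideanSpace ℝ (Fin 3) → EuclideanSpace ℝ (Fin 3)}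
    (hrate : Literature.Analysis.FluidPDE.HasTypeITimeDecay C v)
    (hcont : ContinuousOn (Function.uncurry v) (Set.Iio (0 : ℝ) ×ˢ Set.univ))
    (hmild : ∀ s t : ℝ, s < t → t < 0 → ∀ x, v t x =
      Literature.Analysis.UnboundedOperators.heatExtension (v s) (t - s) x -
        Literature.Analysis.FluidPDE.oseenDuhamel 1 s v v t x)
    (hhot : ∀ t < 0, ∀ x, Real.sqrt (-t) * |v t x 2| ≤ |v (-1) 0 2|) :
    ∀ h : EuclideanSpace ℝ (Fin 3), fderiv ℝ (v (-1)) 0 h 2 = 0 := by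
  have hs : (-1 : ℝ) < 0 := by norm_num
  have hA : AnalyticOnNhd ℝ (v (-1)) Set.univ := analyticOnNhd_slice hcont (bdd_of_hasTypeITimeDecay hrate) hmild hs
  have hd : DifferentiableAt ℝ (v (-1)) 0 := (hA 0 (Set.mem_univ _)).differentiableAt
  set f : EuclideanSpace ℝ (Fin 3) → ℝ := fun x => v (-1) x 2 with hf
  have hfd : DifferentiableAt ℝ f 0 := by
    have := ((EuclideanSpace.proj (𝕜 := ℝ) (2 : Fin 3)).hasFDerivAt.comp (0 : EuclideanSpace ℝ (Fin 3)) hd.hasFDerivAt)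
    exact this.differentiableAt
  have hbound : ∀ x, |f x| ≤ |f 0| := by
    intro x
    have h1 := hhot (-1) hs x
    simpa using h1
  -- `fderiv f 0 = 0`: global max of `f` (if `f 0 ≥ 0`) or global min (if `f 0 ≤ 0`)
  have hcrit : fderiv ℝ f 0 = 0 := by
    rcases le_total 0 (f 0) with h0 | h0
    · have hmax : IsLocalMax f 0 := by
        refine Filter.Eventually.of_forall fun x => ?_
        have := hbound x
        rw [abs_of_nonneg h0] at this
        exact (le_abs_self (f x)).trans this
      exact hmax.fderiv_eq_zero
    · have hmin : IsLocalMin f 0 := by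
        refine Filter.Eventually.of_forall fun x => ?_
        have := hbound x
        rw [abs_of_nonpos h0] at this
        have := (neg_le_abs (f x)).trans this
        linarith
      exact hmin.fderiv_eq_zero
  intro h
  have := fderiv_apply_coord (v (-1)) hd h 2
  rw [← this]
  simp [hf.symm ▸ hcrit]

/-! ### The pins at the hot spot (thread_axis_rung v6 §S5a/S5b, ns-idea-8 g2) -/

/-- **RUNG S5a (time pin; the `∂ₜ` half of the shared provable stub `stub_threadSignedPin`, sorry-free).**
At the hot spot `(−1, 0)` of `√(−t)|v_z|` over the whole past, the time derivative of `v_z` is PINNED: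
`∂ₜ v_z(−1,0) = v_z(−1,0)/2` — Fermat in `t` for `s ↦ √(−s)·σ·v_z(s,0)` (`σ = sign v_z(−1,0)`), time-differentiability
from the joint analyticity of the class (`analyticOnNhd_uncurry`). -/
theorem threadTimePin {v : ℝ → EuclideanSpace ℝ (Fin 3) → EuclideanSpace ℝ (Fin 3)} {C : ℝ}
    (hrate : HasTypeITimeDecay C v)
    (hcont : ContinuousOn (uncurry v) (Iio (0 : ℝ) ×ˢ univ))
    (hmild : ∀ s t : ℝ, s < t → t < 0 → ∀ x, v t x = heatExtension (v s) (t - s) x - oseenDuhamel 1 s v v t x)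
    (hne : v (-1) 0 2 ≠ 0) (hhot : ∀ t < 0, ∀ x, Real.sqrt (-t) * |v t x 2| ≤ |v (-1) 0 2|) :
    deriv (fun s => v s 0 2) (-1) = v (-1) 0 2 / 2 := by
  -- time-differentiability of `s ↦ v_z(s,0)` at `s = −1`
  have han := analyticOnNhd_uncurry hcont (bdd_of_hasTypeITimeDecay hrate) hmild
  have hmem : ((-1 : ℝ), (0 : EuclideanSpace ℝ (Fin 3))) ∈ Iio (0 : ℝ) ×ˢ (univ : Set (EuclideanSpace ℝ (Fin 3))) :=
    mem_prod.2 ⟨by norm_num, mem_univ _⟩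
  have hA : AnalyticAt ℝ (uncurry v) ((-1 : ℝ), (0 : EuclideanSpace ℝ (Fin 3))) := han _ hmem
  have h1 : DifferentiableAt ℝ (fun s : ℝ => (s, (0 : EuclideanSpace ℝ (Fin 3)))) (-1) :=
    differentiableAt_id.prodMk (differentiableAt_const _)
  have h2 : DifferentiableAt ℝ (uncurry v ∘ fun s : ℝ => (s, (0 : EuclideanSpace ℝ (Fin 3)))) (-1) :=
    hA.differentiableAt.comp (-1) h1
  have hfd : DifferentiableAt ℝ (fun s => v s 0 2) (-1) :=
    ((EuclideanSpace.proj (𝕜 := ℝ) (2 : Fin 3)).differentiableAt).comp (-1) h2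
  -- the sign `σ` of `v_z(−1,0)`
  obtain ⟨σ, hσabs, hσa⟩ : ∃ σ : ℝ, |σ| = 1 ∧ σ * v (-1) 0 2 = |v (-1) 0 2| := by
    rcases lt_or_gt_of_ne hne with h | h
    · exact ⟨-1, by simp, by rw [abs_of_neg h]; ring⟩
    · exact ⟨1, by simp, by rw [abs_of_pos h]; ring⟩
  have hσle : ∀ y : ℝ, σ * y ≤ |y| := fun y =>
    calc σ * y ≤ |σ * y| := le_abs_self _
      _ = |y| := by rw [abs_mul, hσabs, one_mul]
  have hσne : σ ≠ 0 := fun h0 => by rw [h0, abs_zero] at hσabs; exact zero_ne_one hσabs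
  -- `g(s) = √(−s)·σ·v_z(s,0)` has a local maximum at `s = −1`
  have hgmax : IsLocalMax (fun s : ℝ => Real.sqrt (-s) * (σ * v s 0 2)) (-1) := by
    have hnhds : ∀ᶠ s in 𝓝 (-1 : ℝ), s < 0 := Iio_mem_nhds (by norm_num)
    filter_upwards [hnhds] with s hs
    have hR : Real.sqrt (-(-1 : ℝ)) = 1 := by norm_num
    rw [hR, one_mul]
    calc Real.sqrt (-s) * (σ * v s 0 2) ≤ Real.sqrt (-s) * |v s 0 2| :=
          mul_le_mul_of_nonneg_left (hσle _) (Real.sqrt_nonneg _)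
      _ ≤ |v (-1) 0 2| := hhot s hs 0
      _ = σ * v (-1) 0 2 := hσa.symm
  have hderiv0 := hgmax.deriv_eq_zero
  -- product rule at `s = −1`
  have hsqrt : HasDerivAt (fun s : ℝ => Real.sqrt (-s)) (1 / (2 * Real.sqrt (-(-1 : ℝ))) * (-1)) (-1) := by
    have hneg : HasDerivAt (fun s : ℝ => -s) (-1) (-1) := hasDerivAt_neg (-1 : ℝ)
    have hs : HasDerivAt Real.sqrt (1 / (2 * Real.sqrt (-(-1 : ℝ)))) (-(-1 : ℝ)) :=
      Real.hasDerivAt_sqrt (by norm_num)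
    exact hs.comp (-1) hneg
  have hg' := hsqrt.mul (hfd.hasDerivAt.const_mul σ)
  have hzero := hg'.deriv.symm.trans hderiv0
  have hR : Real.sqrt (-(-1 : ℝ)) = 1 := by norm_num
  rw [hR] at hzero
  have hkey : σ * (deriv (fun s => v s 0 2) (-1) - v (-1) 0 2 / 2) = 0 := by linear_combination hzero
  rcases mul_eq_zero.1 hkey with h0 | h0
  · exact absurd h0 hσne
  · linarith

/-- 1-D necessity half of the second-derivative test: a `C²` function with a local maximum at `0` has `φ″(0) ≤ 0`. -/
theorem deriv2_nonpos_of_isLocalMax {φ : ℝ → ℝ} (hφ : ContDiff ℝ 2 φ) (hmax : IsLocalMax φ 0) :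
    deriv (deriv φ) 0 ≤ 0 := by
  by_contra hpos
  push Not at hpos
  have hd1 : deriv φ 0 = 0 := hmax.deriv_eq_zero
  have hsign := eventually_nhdsWithin_sign_eq_of_deriv_pos hpos hd1
  obtain ⟨ε, hε, hball⟩ := Metric.eventually_nhds_iff.1 (hsign.and hmax)
  have hdiff : Differentiable ℝ φ := hφ.differentiable (by norm_num)
  have hpos' : ∀ x : ℝ, 0 < x → x < ε → 0 < deriv φ x := by
    intro x hx0 hxε
    have hx : dist x 0 < ε := by rw [Real.dist_eq, sub_zero, abs_of_pos hx0]; exact hxε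
    have h := (hball hx).1
    rw [sub_zero, sign_pos hx0, sign_eq_one_iff] at h
    exact h
  obtain ⟨c, hc, hcd⟩ := exists_deriv_eq_slope φ (by linarith : (0 : ℝ) < ε / 2)
    hdiff.continuous.continuousOn (hdiff.differentiableOn)
  have h1 : 0 < deriv φ c := hpos' c hc.1 (by linarith [hc.2])
  have hε2 : dist (ε / 2) 0 < ε := by rw [Real.dist_eq, sub_zero, abs_of_pos (by linarith)]; linarith
  have h2 : φ (ε / 2) ≤ φ 0 := (hball hε2).2
  rw [hcd, sub_zero] at h1
  have h3 : 0 < φ (ε / 2) - φ 0 := (div_pos_iff_of_pos_right (by linarith)).1 h1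
  linarith

/-- The second derivative of a `C²` function along a line is the second Fréchet derivative on the diagonal. -/
theorem deriv2_line_eq_iteratedFDeriv {f : EuclideanSpace ℝ (Fin 3) → ℝ} (hf : ContDiff ℝ 2 f)
    (x w : EuclideanSpace ℝ (Fin 3)) :
    deriv (deriv (fun t : ℝ => f (x + t • w))) 0 = iteratedFDeriv ℝ 2 f x ![w, w] := by
  have hd : Differentiable ℝ f := hf.differentiable (by norm_num)
  have hd2 : Differentiable ℝ (fderiv ℝ f) :=
    (hf.fderiv_right (m := 1) (by norm_num)).differentiable one_ne_zero
  have hline : ∀ t : ℝ, HasDerivAt (fun t : ℝ => x + t • w) w t := fun t => by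
    simpa using ((hasDerivAt_id t).smul_const w).const_add x
  have h1 : ∀ t : ℝ, HasDerivAt (fun t : ℝ => f (x + t • w)) (fderiv ℝ f (x + t • w) w) t := fun t =>
    (hd (x + t • w)).hasFDerivAt.comp_hasDerivAt t (hline t)
  have h1' : deriv (fun t : ℝ => f (x + t • w)) = fun t => fderiv ℝ f (x + t • w) w :=
    funext fun t => (h1 t).deriv
  rw [h1']
  have hc : HasDerivAt (fun t : ℝ => fderiv ℝ f (x + t • w)) (fderiv ℝ (fderiv ℝ f) (x + (0 : ℝ) • w) w) 0 :=
    (hd2 (x + (0 : ℝ) • w)).hasFDerivAt.comp_hasDerivAt (0 : ℝ) (hline 0)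
  have h2 := hc.clm_apply (hasDerivAt_const (0 : ℝ) w)
  rw [h2.deriv, iteratedFDeriv_two_apply]
  simp

/-- **RUNG S5b (space pin; the Laplacian half of the shared provable stub `stub_threadSignedPin`, sorry-free).**
At the hot spot `(−1,0)`, `v_z(−1,·)` attains `max |v_z(−1,·)|` at `0` (the weight `√(−t)` is `1` at `t = −1`), so
`v_z(−1,0) · Δ v_z(−1,·)(0) ≤ 0` — each pure second derivative of `σ·v_z(−1,·)` along a line through `0` is `≤ 0`
(1-D necessity) and the Laplacian is their sum over an orthonormal basis; `C²` from the slice analyticity of the class. -/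
theorem threadSpacePin {v : ℝ → EuclideanSpace ℝ (Fin 3) → EuclideanSpace ℝ (Fin 3)} {C : ℝ}
    (hrate : HasTypeITimeDecay C v)
    (hcont : ContinuousOn (uncurry v) (Iio (0 : ℝ) ×ˢ univ))
    (hmild : ∀ s t : ℝ, s < t → t < 0 → ∀ x, v t x = heatExtension (v s) (t - s) x - oseenDuhamel 1 s v v t x)
    (hne : v (-1) 0 2 ≠ 0) (hhot : ∀ t < 0, ∀ x, Real.sqrt (-t) * |v t x 2| ≤ |v (-1) 0 2|) :
    v (-1) 0 2 * (Δ (fun y => v (-1) y 2)) 0 ≤ 0 := by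
  set f : EuclideanSpace ℝ (Fin 3) → ℝ := fun y => v (-1) y 2 with hf
  have hfa : ContDiff ℝ 2 f := by
    have hsl := analyticOnNhd_slice hcont (bdd_of_hasTypeITimeDecay hrate) hmild (by norm_num : (-1 : ℝ) < 0)
    have han : AnalyticOnNhd ℝ f univ := fun y _ =>
      ((EuclideanSpace.proj (𝕜 := ℝ) (2 : Fin 3)).analyticAt _).comp (hsl y (mem_univ _))
    exact han.contDiff
  obtain ⟨σ, hσabs, hσa⟩ : ∃ σ : ℝ, |σ| = 1 ∧ σ * v (-1) 0 2 = |v (-1) 0 2| := by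
    rcases lt_or_gt_of_ne hne with h | h
    · exact ⟨-1, by simp, by rw [abs_of_neg h]; ring⟩
    · exact ⟨1, by simp, by rw [abs_of_pos h]; ring⟩
  have hσle : ∀ y : ℝ, σ * y ≤ |y| := fun y =>
    calc σ * y ≤ |σ * y| := le_abs_self _
      _ = |y| := by rw [abs_mul, hσabs, one_mul]
  have hσ2 : σ * σ = 1 := by
    have h := congrArg (fun r : ℝ => r ^ 2) hσabs
    simp only [sq_abs, one_pow] at h
    nlinarith [h]
  -- every pure second derivative of `σ f` through `0` is `≤ 0`
  have hw : ∀ w : EuclideanSpace ℝ (Fin 3), σ * iteratedFDeriv ℝ 2 f 0 ![w, w] ≤ 0 := by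
    intro w
    have hφc : ContDiff ℝ 2 (fun t : ℝ => σ * f (0 + t • w)) :=
      contDiff_const.mul (hfa.comp (contDiff_const.add (contDiff_id.smul contDiff_const)))
    have hmax : IsLocalMax (fun t : ℝ => σ * f (0 + t • w)) 0 := by
      refine Filter.Eventually.of_forall fun t => ?_
      show σ * f (0 + t • w) ≤ σ * f (0 + (0 : ℝ) • w)
      simp only [zero_smul, add_zero, zero_add]
      have hh := hhot (-1) (by norm_num) (t • w)
      have hR : Real.sqrt (-(-1 : ℝ)) = 1 := by norm_num
      rw [hR, one_mul] at hh
      calc σ * f (t • w) ≤ |f (t • w)| := hσle _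
        _ ≤ |v (-1) 0 2| := hh
        _ = σ * f 0 := hσa.symm
    have hA := deriv2_nonpos_of_isLocalMax hφc hmax
    have hB : deriv (deriv (fun t : ℝ => σ * f (0 + t • w))) 0 = σ * iteratedFDeriv ℝ 2 f 0 ![w, w] := by
      rw [← deriv2_line_eq_iteratedFDeriv hfa 0 w]
      have e1 : deriv (fun t : ℝ => σ * f (0 + t • w)) = fun t => σ * deriv (fun t : ℝ => f (0 + t • w)) t :=
        deriv_const_mul_field' σ
      rw [e1, deriv_const_mul_field']
    rw [hB] at hA
    exact hA
  rw [InnerProductSpace.laplacian_eq_iteratedFDeriv_orthonormalBasis f (EuclideanSpace.basisFun (Fin 3) ℝ)]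
  have hS : σ * ∑ i, iteratedFDeriv ℝ 2 f 0
      ![(EuclideanSpace.basisFun (Fin 3) ℝ) i, (EuclideanSpace.basisFun (Fin 3) ℝ) i] ≤ 0 := by
    rw [Finset.mul_sum]
    exact Finset.sum_nonpos fun i _ => hw _
  have haσ : v (-1) 0 2 = |v (-1) 0 2| * σ := by
    calc v (-1) 0 2 = (σ * σ) * v (-1) 0 2 := by rw [hσ2, one_mul]
      _ = (σ * v (-1) 0 2) * σ := by ring
      _ = |v (-1) 0 2| * σ := by rw [hσa]
  rw [haσ, mul_assoc]
  exact mul_nonpos_of_nonneg_of_nonpos (abs_nonneg _) hS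

/-- **The lines' shared stub S5 `stub_threadSignedPin`, PROVED — statement verbatim** (thread_axis_rung v6 `threadSignedPin_holds`,
ns-idea-8 g2; relayed). -/
theorem threadSignedPin :
    ∀ (C : ℝ) (v : ℝ → EuclideanSpace ℝ (Fin 3) → EuclideanSpace ℝ (Fin 3)),
      Literature.Analysis.FluidPDE.HasTypeITimeDecay C v →
      ContinuousOn (Function.uncurry v) (Set.Iio (0 : ℝ) ×ˢ Set.univ) →
      (∀ s t : ℝ, s < t → t < 0 → ∀ x, v t x =
        Literature.Analysis.UnboundedOperators.heatExtension (v s) (t - s) x -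
          Literature.Analysis.FluidPDE.oseenDuhamel 1 s v v t x) →
      (∀ t < 0, Literature.Analysis.FluidPDE.VectorCalculus.IsDivFree (v t)) →
      v (-1) 0 2 ≠ 0 → (∀ t < 0, ∀ x, Real.sqrt (-t) * |v t x 2| ≤ |v (-1) 0 2|) →
      (deriv (fun s => v s 0 2) (-1) = v (-1) 0 2 / 2 ∧ v (-1) 0 2 * (Δ (fun y => v (-1) y 2)) 0 ≤ 0) :=
  fun _ _ hrate hcont hmild _ hne hhot =>
    ⟨threadTimePin hrate hcont hmild hne hhot, threadSpacePin hrate hcont hmild hne hhot⟩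

/-! ### The packaged normal form -/

/-- **THREADED HOT-SPOT NORMAL FORM (S1 + thread + S5).**  A profile of the route's Type-I class (rate `C`, joint continuity,
Oseen-mild, divergence-free), poloidal along `e₃`, with `v₂ ≢ 0` on the slab, has a companion `v'` in the SAME class, poloidal, with:
the hot spot `√(−t)|v'₂(t,x)| ≤ |v'₂(−1,0)| ≠ 0` on the slab (`extremalThread`), a THREAD there `Dv'(−1)(0)[h]₂ = 0` for all `h`
(`threadPin_of_hotSpot`), the time pin `∂ₜv'₂(−1,0) = v'₂(−1,0)/2` and the signed Laplacian pin `v'₂(−1,0)·Δv'₂(−1,·)(0) ≤ 0`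
(`threadSignedPin`). [folklore] -/
theorem exists_threadedHotSpot :
    ∀ (C : ℝ) (v : ℝ → EuclideanSpace ℝ (Fin 3) → EuclideanSpace ℝ (Fin 3)),
      Literature.Analysis.FluidPDE.HasTypeITimeDecay C v →
      ContinuousOn (Function.uncurry v) (Set.Iio (0 : ℝ) ×ˢ Set.univ) →
      (∀ s t : ℝ, s < t → t < 0 → ∀ x, v t x =
        Literature.Analysis.UnboundedOperators.heatExtension (v s) (t - s) x -
          Literature.Analysis.FluidPDE.oseenDuhamel 1 s v v t x) →
      (∀ t < 0, Literature.Analysis.FluidPDE.VectorCalculus.IsDivFree (v t)) →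
      (∀ s < 0, ∀ y, ⟪Literature.Analysis.FluidPDE.curl (v s) y, EuclideanSpace.single 2 1⟫_ℝ = 0) →
      (∃ t₀ : ℝ, t₀ < 0 ∧ ∃ y₀ : EuclideanSpace ℝ (Fin 3), v t₀ y₀ 2 ≠ 0) →
      ∃ v' : ℝ → EuclideanSpace ℝ (Fin 3) → EuclideanSpace ℝ (Fin 3),
        Literature.Analysis.FluidPDE.HasTypeITimeDecay C v' ∧
        ContinuousOn (Function.uncurry v') (Set.Iio (0 : ℝ) ×ˢ Set.univ) ∧
        (∀ s t : ℝ, s < t → t < 0 → ∀ x, v' t x =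
          Literature.Analysis.UnboundedOperators.heatExtension (v' s) (t - s) x -
            Literature.Analysis.FluidPDE.oseenDuhamel 1 s v' v' t x) ∧
        (∀ t < 0, Literature.Analysis.FluidPDE.VectorCalculus.IsDivFree (v' t)) ∧
        (∀ s < 0, ∀ y, ⟪Literature.Analysis.FluidPDE.curl (v' s) y, EuclideanSpace.single 2 1⟫_ℝ = 0) ∧
        v' (-1) 0 2 ≠ 0 ∧ (∀ t < 0, ∀ x, Real.sqrt (-t) * |v' t x 2| ≤ |v' (-1) 0 2|) ∧
        (∀ h : EuclideanSpace ℝ (Fin 3), fderiv ℝ (v' (-1)) 0 h 2 = 0) ∧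
        deriv (fun s => v' s 0 2) (-1) = v' (-1) 0 2 / 2 ∧
        v' (-1) 0 2 * (Δ (fun y => v' (-1) y 2)) 0 ≤ 0 := by
  intro C v hrate hcont hmild hdiv hpol hne
  obtain ⟨v', hrate', hcont', hmild', hdiv', hpol', hne', hhot'⟩ := extremalThread C v hrate hcont hmild hdiv hpol hne
  obtain ⟨ht', hs'⟩ := threadSignedPin C v' hrate' hcont' hmild' hdiv' hne' hhot'
  exact ⟨v', hrate', hcont', hmild', hdiv', hpol', hne', hhot', threadPin_of_hotSpot hrate' hcont' hmild' hhot', ht', hs'⟩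

end Summit.NavierStokesRegularity.NavierStokesRegularity.Theorems.PoloidalWindowDoorLrcModEntireThreadPins
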